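import Summits.CriticalPhenomena.SAWScalingLimit.Theorems.SAWDefectDecoherenceObservableToSLERTwoPieceAdmIdentificationSandwich
import Summits.CriticalPhenomena.SAWScalingLimit.Theorems.SAWDefectDecoherenceObservableToSLERTwoPieceAdmIdentificationClosing
import HarnessLib

/-!
# Crux `SAWDevelopingMap.ObservableToSLE` (stmt-CriticalPhenomena-10472), line `six-class-type-ladder`
(slug `Sketch`), stub T2a `stub_twoPieceAdmIdentification`: THE FINAL ASSEMBLY of the LSW closing
for a fixed two-piece flat Dobrushin domain and a given admissible family

Landing target:
`Summits/CriticalPhenomena/SAWScalingLimit/Theorems/SAWDevelopingMapObservableToSLETypeLadderTwoPieceAdmIdentification.lean`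
(`--supports stmt-CriticalPhenomena-10472`; the SAME registered signature is stub 5a3 of the twin
crux stmt-CriticalPhenomena-14005, whose landed chain
`Theorems.ObservableToSLER.TwoPiece.*` (`…TwoPieceAdmIdentification{Law, Limits, Walks, Exclusion,
Closing, Flat, Component, Mesh, Clauses, Family, Sandwich}`) this file completes and closes).

`isSLELaw_of_admRestrictionLimit` — from the two-piece admissible restriction limit (ARL″, the
first hypothesis, verbatim), a two-piece flat Dobrushin domain `(M; a, b)`, an admissible family
`Λ δ`, and a probability weak limit `μ` of the Duminil-Copin–Smirnov laws along meshes `s n → 0⁺`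
with a uniform injectivity modulus, `μ` is the chordal SLE(8/3) law of `M`:
* endpoints and confinement of `μ`-a.e. class (`ae_source_eq_of_ratio`, `ae_target_eq_of_ratio`,
  `ae_range_subset_closure_of_ratio` fed by the fixed-mesh facts `dist_source_latticeCurve_le`,
  `dist_target_latticeCurve_le`, `range_latticeCurve_subset_cthickening_of_subset`);
* simplicity from the modulus hypothesis (`ae_mem_simple_of_ratio`);
* the restriction sandwich over all hull subdomains (`sandwich_of_admRestrictionLimit`): its upper
  half gives the chordal carrier (`ae_mem_chordalCarrier_of_upper`), which unlocks its lower half;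
* the LSW closing for an abstract law (`isSLELaw_of_carrier_of_sandwich`:
  `CurveClass.Measure.ext_of_missCode_injOn` + [LSW03] Thm. 6.1).
`stub_twoPieceAdmIdentification` is the registry form (the registered signature, verbatim).
-/

noncomputable section

open scoped BigOperators Topology NNReal ENNReal Classical BoundedContinuousFunction ComplexConjugate
open Filter Set MeasureTheory Metric
open Literature.Probability.LatticeModels (HexVertex hexGraph hexCenter polyline)
open Literature.Probability.RandomPlanarGeometry
open Literature.Probability.RandomPlanarGeometry.SAW
open UpperHalfPlane (upperHalfPlaneSet)

namespace Summit.CriticalPhenomena.SAWScalingLimit.Theorems.ObservableToSLE.TypeLadder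

open Summit.CriticalPhenomena.SAWScalingLimit.Theorems.ObservableToSLER.TwoPiece

/-! ### The assembly -/

/-- **THE LSW CLOSING FOR A FIXED TWO-PIECE FLAT DOMAIN AND A GIVEN ADMISSIBLE FAMILY.**  Assume
the two-piece admissible restriction limit (ARL″).  Let `(M; a, b)` be a two-piece flat Dobrushin
domain, `Λ δ` an admissible family (simply connected, connected, end mid-edges on the boundary
tending to the marked points, centres in `M`, half-plane rows in the two flat balls, exhausting
the compacts of `M`), and `μ` a probability weak limit of the Duminil-Copin–Smirnov laws of the
rescaled polylines along meshes `s n → 0⁺` carrying a uniform injectivity modulus.  Then `μ` is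
the chordal SLE(8/3) law of `M`: `μ`-a.e. class runs from `a` to `b` inside `cl M` (portmanteau on
closed sets), is simple (modulus), is carried by the chordal carrier (upper sandwich through collar
hulls), and satisfies the full restriction sandwich, whence the identification.
[cite: LawlerSchrammWerner2003Restriction, Lemma 3.2 (p. 10), Thm. 6.1 (p. 23), §8.1 (p. 31), transposed; LawlerSchrammWerner2004SAW, §3.4; BillingsleyCPM1999, Thm. 2.1] -/
theorem isSLELaw_of_admRestrictionLimit
    (hARL : ∀ (D D' : DobrushinDomain) (ρ : ℝ) (φ : ConformalEquiv upperHalfPlaneSet D.carrier)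
      (Φ : ConformalEquiv (upperHalfPlaneSet \ φ.pullbackHull D') upperHalfPlaneSet) (d : ℝ)
      (Λ Λ' : ℝ → Finset HexVertex) (m₀ m₁ m₁' : ℝ → ℤ) (a b : ℝ → Sym2 HexVertex),
      (0 < ρ ∧ ∀ i : Fin 2, D.carrier ∩ ball (D.pt i) ρ = {z : ℂ | (D.pt i).im < z.im} ∩ ball (D.pt i) ρ) →
      D.IsHullSubdomain D' → D.IsChordalUniformizing φ →
      IsRestrictionMap (φ.pullbackHull D') Φ → HasRestrictionDeriv (φ.pullbackHull D') Φ d →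
      (∀ᶠ δ : ℝ in 𝓝[>] 0,
        Λ' δ ⊆ Λ δ ∧ hexDomainSimplyConnected (Λ δ) ∧ hexDomainSimplyConnected (Λ' δ) ∧
        (hexGraph.induce (↑(Λ δ) : Set HexVertex)).Preconnected ∧
        (hexGraph.induce (↑(Λ' δ) : Set HexVertex)).Preconnected ∧
        a δ ∈ hexDomainBoundary (Λ δ) ∧ b δ ∈ hexDomainBoundary (Λ δ) ∧
        a δ ∈ hexDomainBoundary (Λ' δ) ∧ b δ ∈ hexDomainBoundary (Λ' δ) ∧
        Nonempty (HexMidEdgeSAW (Λ' δ) (a δ) (b δ)) ∧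
        (∀ v ∈ Λ δ, (δ : ℂ) * hexCenter v ∈ D.carrier) ∧
        (∀ v ∈ Λ' δ, (δ : ℂ) * hexCenter v ∈ D'.carrier) ∧
        (∀ v : HexVertex, (δ : ℂ) * hexCenter v ∈ ball (D.pt 0) ρ →
          ((v ∈ Λ δ ↔ m₀ δ ≤ v.1 1) ∧ (v ∈ Λ' δ ↔ m₀ δ ≤ v.1 1))) ∧
        (∀ v : HexVertex, (δ : ℂ) * hexCenter v ∈ ball (D.pt 1) ρ →
          ((v ∈ Λ δ ↔ m₁ δ ≤ v.1 1) ∧ (v ∈ Λ' δ ↔ m₁' δ ≤ v.1 1)))) →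
      (∀ K : Set ℂ, IsCompact K → K ⊆ D.carrier →
        ∀ᶠ δ : ℝ in 𝓝[>] 0, ∀ v : HexVertex, (δ : ℂ) * hexCenter v ∈ K → v ∈ Λ δ) →
      (∀ K : Set ℂ, IsCompact K → K ⊆ D'.carrier →
        ∀ᶠ δ : ℝ in 𝓝[>] 0, ∀ v : HexVertex, (δ : ℂ) * hexCenter v ∈ K → v ∈ Λ' δ) →
      Tendsto (fun δ : ℝ => (δ : ℂ) * hexMidpoint (a δ)) (𝓝[>] 0) (𝓝 (D.pt 0)) →
      Tendsto (fun δ : ℝ => (δ : ℂ) * hexMidpoint (b δ)) (𝓝[>] 0) (𝓝 (D.pt 1)) →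
      Tendsto (fun δ : ℝ =>
          (∑ γ : HexMidEdgeSAW (Λ' δ) (a δ) (b δ), hexCriticalFugacity ^ γ.length) /
            (∑ γ : HexMidEdgeSAW (Λ δ) (a δ) (b δ), hexCriticalFugacity ^ γ.length)) (𝓝[>] 0)
        (𝓝 (d ^ ((5 : ℝ) / 8))))
    {M : DobrushinDomain} {ρ : ℝ} {Λ : ℝ → Finset HexVertex} {m : Fin 2 → ℝ → ℤ}
    {a b : ℝ → Sym2 HexVertex}
    (hflat : 0 < ρ ∧ ∀ i : Fin 2, M.carrier ∩ ball (M.pt i) ρ =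
      {z : ℂ | (M.pt i).im < z.im} ∩ ball (M.pt i) ρ)
    (hadm : ∀ᶠ δ : ℝ in 𝓝[>] 0, hexDomainSimplyConnected (Λ δ) ∧ a δ ∈ hexDomainBoundary (Λ δ) ∧
      b δ ∈ hexDomainBoundary (Λ δ) ∧ Nonempty (HexMidEdgeSAW (Λ δ) (a δ) (b δ)) ∧
      (hexGraph.induce (↑(Λ δ) : Set HexVertex)).Preconnected ∧
      (∀ v ∈ Λ δ, (δ : ℂ) * hexCenter v ∈ M.carrier) ∧
      (∀ i : Fin 2, ∀ v : HexVertex, (δ : ℂ) * hexCenter v ∈ ball (M.pt i) ρ →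
        (v ∈ Λ δ ↔ m i δ ≤ v.1 1)))
    (hexh : ∀ K : Set ℂ, IsCompact K → K ⊆ M.carrier →
      ∀ᶠ δ : ℝ in 𝓝[>] 0, ∀ v : HexVertex, (δ : ℂ) * hexCenter v ∈ K → v ∈ Λ δ)
    (ha : Tendsto (fun δ : ℝ => (δ : ℂ) * hexMidpoint (a δ)) (𝓝[>] 0) (𝓝 (M.pt 0)))
    (hb : Tendsto (fun δ : ℝ => (δ : ℂ) * hexMidpoint (b δ)) (𝓝[>] 0) (𝓝 (M.pt 1)))
    {μ : Measure (CurveClass ℂ)} [IsProbabilityMeasure μ] {s : ℕ → ℝ}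
    (hs : Tendsto s atTop (𝓝[>] 0))
    (hconv : ∀ f : CurveClass ℂ →ᵇ ℝ,
      Tendsto (fun n =>
        (∑ γ : HexMidEdgeSAW (Λ (s n)) (a (s n)) (b (s n)),
            hexCriticalFugacity ^ γ.length *
              f (CurveClass.mk ⟨polyline (γ.verts.map fun v => ((s n : ℝ) : ℂ) * hexCenter v)⟩)) /
          (∑ γ : HexMidEdgeSAW (Λ (s n)) (a (s n)) (b (s n)), hexCriticalFugacity ^ γ.length))
        atTop (𝓝 (∫ x, f x ∂μ)))
    (hmod : ∀ ε η : ℝ, 0 < ε → 0 < η → ∃ θ : ℝ, 0 < θ ∧ ∀ᶠ n in atTop,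
      (∑ γ : HexMidEdgeSAW (Λ (s n)) (a (s n)) (b (s n)),
          if CurveClass.mk ⟨polyline (γ.verts.map fun v => ((s n : ℝ) : ℂ) * hexCenter v)⟩ ∉
              CurveClass.modulusClass ε θ
          then hexCriticalFugacity ^ γ.length else 0) ≤
        η * ∑ γ : HexMidEdgeSAW (Λ (s n)) (a (s n)) (b (s n)), hexCriticalFugacity ^ γ.length) :
    IsSLELaw ((8 : ℝ≥0) / 3) M μ := by
  have h01 : M.pt 0 ≠ M.pt 1 := fun h => absurd (M.pt_injective h) (by decide)
  -- eventual facts along the sequence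
  have hne : ∀ᶠ n in atTop, Nonempty (HexMidEdgeSAW (Λ (s n)) (a (s n)) (b (s n))) :=
    hs.eventually (hadm.mono fun δ h => h.2.2.2.1)
  have hab : ∀ᶠ n in atTop, a (s n) ≠ b (s n) :=
    hs.eventually (eventually_ne_of_tendsto_midpoint h01 ha hb)
  have hadm' := hs.eventually hadm
  have hpos : ∀ᶠ n in atTop, 0 < s n := hs.eventually eventually_mem_nhdsWithin
  have hsmall : ∀ ε : ℝ, 0 < ε → ∀ᶠ n in atTop, s n < ε := fun ε hε =>
    hs.eventually (by filter_upwards [Ioo_mem_nhdsGT hε] with δ hδ using hδ.2)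
  -- endpoints
  have hsrc : ∀ᵐ c ∂μ, c.source = M.pt 0 := by
    refine ae_source_eq_of_ratio hne hconv fun ε hε => ?_
    have h1 : ∀ᶠ n in atTop, dist (((s n : ℝ) : ℂ) * hexMidpoint (a (s n))) (M.pt 0) < ε / 2 :=
      (ha.comp hs).eventually (ball_mem_nhds _ (half_pos hε))
    filter_upwards [h1, hsmall (ε / 2) (half_pos hε), hpos, hadm', hab] with n h1 h2 h0 hc hn γ
    calc dist (CurveClass.mk ⟨polyline (γ.verts.map fun v => ((s n : ℝ) : ℂ) * hexCenter v)⟩).source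
          (M.pt 0)
        ≤ dist (CurveClass.mk ⟨polyline (γ.verts.map fun v => ((s n : ℝ) : ℂ) * hexCenter v)⟩).source
            (((s n : ℝ) : ℂ) * hexMidpoint (a (s n))) +
          dist (((s n : ℝ) : ℂ) * hexMidpoint (a (s n))) (M.pt 0) := dist_triangle _ _ _
      _ ≤ s n + ε / 2 := add_le_add (dist_source_latticeCurve_le h0.le hc.2.1 hn γ) h1.le
      _ ≤ ε := by linarith
  have htgt : ∀ᵐ c ∂μ, c.target = M.pt 1 := by
    refine ae_target_eq_of_ratio hne hconv fun ε hε => ?_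
    have h1 : ∀ᶠ n in atTop, dist (((s n : ℝ) : ℂ) * hexMidpoint (b (s n))) (M.pt 1) < ε / 2 :=
      (hb.comp hs).eventually (ball_mem_nhds _ (half_pos hε))
    filter_upwards [h1, hsmall (ε / 2) (half_pos hε), hpos, hadm', hab] with n h1 h2 h0 hc hn γ
    calc dist (CurveClass.mk ⟨polyline (γ.verts.map fun v => ((s n : ℝ) : ℂ) * hexCenter v)⟩).target
          (M.pt 1)
        ≤ dist (CurveClass.mk ⟨polyline (γ.verts.map fun v => ((s n : ℝ) : ℂ) * hexCenter v)⟩).target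
            (((s n : ℝ) : ℂ) * hexMidpoint (b (s n))) +
          dist (((s n : ℝ) : ℂ) * hexMidpoint (b (s n))) (M.pt 1) := dist_triangle _ _ _
      _ ≤ s n + ε / 2 := add_le_add (dist_target_latticeCurve_le h0.le hc.2.2.1 hn γ) h1.le
      _ ≤ ε := by linarith
  have hends : ∀ᵐ c ∂μ, c.source = M.pt 0 ∧ c.target = M.pt 1 := by
    filter_upwards [hsrc, htgt] with c h1 h2 using ⟨h1, h2⟩
  -- confinement
  have hconf : ∀ᵐ c ∂μ, c.range ⊆ closure M.carrier := by
    refine ae_range_subset_closure_of_ratio hne hconv fun ε hε => ?_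
    filter_upwards [hsmall ε hε, hpos, hadm', hab] with n h2 h0 hc hn γ
    exact (range_latticeCurve_subset_cthickening_of_subset h0.le hc.2.2.2.2.2.1 hn γ γ.subset).trans
      (cthickening_mono h2.le _)
  -- simplicity
  have hsimple : ∀ᵐ c ∂μ, c ∈ CurveClass.simple := by
    refine ae_mem_simple_of_ratio hne hconv ?_ hmod
    filter_upwards [hends] with c hc
    rw [hc.1, hc.2]
    exact h01
  -- the sandwich, the carrier, the closing
  have hupper : ∀ (D' : DobrushinDomain) (φ : ConformalEquiv upperHalfPlaneSet M.carrier)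
      (Φ : ConformalEquiv (upperHalfPlaneSet \ φ.pullbackHull D') upperHalfPlaneSet) (d : ℝ),
      M.IsHullSubdomain D' → M.IsChordalUniformizing φ →
      IsRestrictionMap (φ.pullbackHull D') Φ → HasRestrictionDeriv (φ.pullbackHull D') Φ d →
      ENNReal.ofReal (d ^ ((5 : ℝ) / 8)) ≤ μ (CurveClass.rangeSubset (closure D'.carrier)) :=
    fun D' φ Φ d hD' hφ hΦ hd =>
      (sandwich_of_admRestrictionLimit hARL hflat hadm hexh ha hb hs hconv hD' hφ hΦ hd).1
  have hcar : ∀ᵐ c ∂μ, c ∈ chordalCarrier M := ae_mem_chordalCarrier_of_upper hsimple hends hconf hupper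
  exact isSLELaw_of_carrier_of_sandwich hcar fun D' φ Φ d hD' hφ hΦ hd =>
    ⟨(sandwich_of_admRestrictionLimit hARL hflat hadm hexh ha hb hs hconv hD' hφ hΦ hd).2 hcar,
      hupper D' φ Φ d hD' hφ hΦ hd⟩

/-! ### Registry form -/

/-- **Registered stub T2a `stub_twoPieceAdmIdentification`** (crux item stmt-CriticalPhenomena-10472,
line `six-class-type-ladder`; = stub 5a3 of the twin crux stmt-CriticalPhenomena-14005, SAME
signature): `TwoPieceAdmRestrictionLimit → TwoPieceAdmIdentification`, both inlined — the registry
form of `isSLELaw_of_admRestrictionLimit`.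
[cite: LawlerSchrammWerner2003Restriction, Lemma 3.2 (p. 10), Thm. 6.1 (p. 23), §8.1 (p. 31), transposed; LawlerSchrammWerner2004SAW, §3.4] -/
theorem stub_twoPieceAdmIdentification :
    (∀ (D D' : DobrushinDomain) (ρ : ℝ) (φ : ConformalEquiv upperHalfPlaneSet D.carrier)
      (Φ : ConformalEquiv (upperHalfPlaneSet \ φ.pullbackHull D') upperHalfPlaneSet) (d : ℝ)
      (Λ Λ' : ℝ → Finset HexVertex) (m₀ m₁ m₁' : ℝ → ℤ) (a b : ℝ → Sym2 HexVertex),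
      (0 < ρ ∧ ∀ i : Fin 2, D.carrier ∩ ball (D.pt i) ρ = {z : ℂ | (D.pt i).im < z.im} ∩ ball (D.pt i) ρ) →
      D.IsHullSubdomain D' → D.IsChordalUniformizing φ →
      IsRestrictionMap (φ.pullbackHull D') Φ → HasRestrictionDeriv (φ.pullbackHull D') Φ d →
      (∀ᶠ δ : ℝ in 𝓝[>] 0,
        Λ' δ ⊆ Λ δ ∧ hexDomainSimplyConnected (Λ δ) ∧ hexDomainSimplyConnected (Λ' δ) ∧
        (hexGraph.induce (↑(Λ δ) : Set HexVertex)).Preconnected ∧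
        (hexGraph.induce (↑(Λ' δ) : Set HexVertex)).Preconnected ∧
        a δ ∈ hexDomainBoundary (Λ δ) ∧ b δ ∈ hexDomainBoundary (Λ δ) ∧
        a δ ∈ hexDomainBoundary (Λ' δ) ∧ b δ ∈ hexDomainBoundary (Λ' δ) ∧
        Nonempty (HexMidEdgeSAW (Λ' δ) (a δ) (b δ)) ∧
        (∀ v ∈ Λ δ, (δ : ℂ) * hexCenter v ∈ D.carrier) ∧
        (∀ v ∈ Λ' δ, (δ : ℂ) * hexCenter v ∈ D'.carrier) ∧
        (∀ v : HexVertex, (δ : ℂ) * hexCenter v ∈ ball (D.pt 0) ρ →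
          ((v ∈ Λ δ ↔ m₀ δ ≤ v.1 1) ∧ (v ∈ Λ' δ ↔ m₀ δ ≤ v.1 1))) ∧
        (∀ v : HexVertex, (δ : ℂ) * hexCenter v ∈ ball (D.pt 1) ρ →
          ((v ∈ Λ δ ↔ m₁ δ ≤ v.1 1) ∧ (v ∈ Λ' δ ↔ m₁' δ ≤ v.1 1)))) →
      (∀ K : Set ℂ, IsCompact K → K ⊆ D.carrier →
        ∀ᶠ δ : ℝ in 𝓝[>] 0, ∀ v : HexVertex, (δ : ℂ) * hexCenter v ∈ K → v ∈ Λ δ) →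
      (∀ K : Set ℂ, IsCompact K → K ⊆ D'.carrier →
        ∀ᶠ δ : ℝ in 𝓝[>] 0, ∀ v : HexVertex, (δ : ℂ) * hexCenter v ∈ K → v ∈ Λ' δ) →
      Tendsto (fun δ : ℝ => (δ : ℂ) * hexMidpoint (a δ)) (𝓝[>] 0) (𝓝 (D.pt 0)) →
      Tendsto (fun δ : ℝ => (δ : ℂ) * hexMidpoint (b δ)) (𝓝[>] 0) (𝓝 (D.pt 1)) →
      Tendsto (fun δ : ℝ =>
          (∑ γ : HexMidEdgeSAW (Λ' δ) (a δ) (b δ), hexCriticalFugacity ^ γ.length) /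
            (∑ γ : HexMidEdgeSAW (Λ δ) (a δ) (b δ), hexCriticalFugacity ^ γ.length)) (𝓝[>] 0)
        (𝓝 (d ^ ((5 : ℝ) / 8)))) →
    ∀ (M : DobrushinDomain) (ρ : ℝ) (Λ : ℝ → Finset HexVertex) (m : Fin 2 → ℝ → ℤ)
      (a b : ℝ → Sym2 HexVertex),
      (0 < ρ ∧ ∀ i : Fin 2, M.carrier ∩ ball (M.pt i) ρ = {z : ℂ | (M.pt i).im < z.im} ∩ ball (M.pt i) ρ) →
      (∀ᶠ δ : ℝ in 𝓝[>] 0, hexDomainSimplyConnected (Λ δ) ∧ a δ ∈ hexDomainBoundary (Λ δ) ∧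
        b δ ∈ hexDomainBoundary (Λ δ) ∧ Nonempty (HexMidEdgeSAW (Λ δ) (a δ) (b δ)) ∧
        (hexGraph.induce (↑(Λ δ) : Set HexVertex)).Preconnected ∧
        (∀ v ∈ Λ δ, (δ : ℂ) * hexCenter v ∈ M.carrier) ∧
        (∀ i : Fin 2, ∀ v : HexVertex, (δ : ℂ) * hexCenter v ∈ ball (M.pt i) ρ →
          (v ∈ Λ δ ↔ m i δ ≤ v.1 1))) →
      (∀ K : Set ℂ, IsCompact K → K ⊆ M.carrier →
        ∀ᶠ δ : ℝ in 𝓝[>] 0, ∀ v : HexVertex, (δ : ℂ) * hexCenter v ∈ K → v ∈ Λ δ) →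
      Tendsto (fun δ : ℝ => (δ : ℂ) * hexMidpoint (a δ)) (𝓝[>] 0) (𝓝 (M.pt 0)) →
      Tendsto (fun δ : ℝ => (δ : ℂ) * hexMidpoint (b δ)) (𝓝[>] 0) (𝓝 (M.pt 1)) →
      ∀ (μ : Measure (CurveClass ℂ)) (s : ℕ → ℝ), IsProbabilityMeasure μ →
        Tendsto s atTop (𝓝[>] 0) →
        (∀ f : CurveClass ℂ →ᵇ ℝ,
          Tendsto (fun n =>
            (∑ γ : HexMidEdgeSAW (Λ (s n)) (a (s n)) (b (s n)),
                hexCriticalFugacity ^ γ.length *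
                  f (CurveClass.mk ⟨polyline (γ.verts.map fun v => ((s n : ℝ) : ℂ) * hexCenter v)⟩)) /
              (∑ γ : HexMidEdgeSAW (Λ (s n)) (a (s n)) (b (s n)), hexCriticalFugacity ^ γ.length))
            atTop (𝓝 (∫ x, f x ∂μ))) →
        (∀ ε η : ℝ, 0 < ε → 0 < η → ∃ θ : ℝ, 0 < θ ∧ ∀ᶠ n in atTop,
          (∑ γ : HexMidEdgeSAW (Λ (s n)) (a (s n)) (b (s n)),
              if CurveClass.mk ⟨polyline (γ.verts.map fun v => ((s n : ℝ) : ℂ) * hexCenter v)⟩ ∉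
                  CurveClass.modulusClass ε θ
              then hexCriticalFugacity ^ γ.length else 0) ≤
            η * ∑ γ : HexMidEdgeSAW (Λ (s n)) (a (s n)) (b (s n)), hexCriticalFugacity ^ γ.length) →
        IsSLELaw ((8 : ℝ≥0) / 3) M μ :=
  fun hARL _M _ρ _Λ _m _a _b hflat hadm hexh ha hb _μ _s hμ hs hconv hmod => by
    haveI := hμ
    exact isSLELaw_of_admRestrictionLimit hARL hflat hadm hexh ha hb hs hconv hmod

end Summit.CriticalPhenomena.SAWScalingLimit.Theorems.ObservableToSLE.TypeLadder

end
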